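import Summits.BirchSwinnertonDyer.Rank1Residual.Iwasawa.SelmerInftyTrivialOfLevelZero
import Literature.NumberTheory.EllipticCurves.IwasawaTowerTorsionProofs
import HarnessLib

/-!
# The duality-free Euler-characteristic inequality by control: trivial level-`0` local tower
# kernels ⟹ `ker g_0 = 0` ⟹ `f(0) · #(Sel_∞)_Γ · #E[p^∞]^{Γ_K} = u · #Sel_{p^∞}(E/K)`, hence
# `f(0) ∣ #Sel_{p^∞}(E/K)` in `ℤ_p` (team n1011, row T-CTL-EC, seat p06 GEN 9, FILE 1 — TOOL)

HONEST FRAMING (cell `b2b-bsdres-*`, team n1011, verbatim): prove what is provable now; shrink each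
hard class to its core with data; no claim beyond stated classes. Research route; TOOL theorems
only — no definition, no named fact, nothing booked, no residual-map mark moved, no class closed.

## What

The tree carries Greenberg's Theorem 4.1 (LNM 1716, p. 102) "reduced to Lemmas 4.4 and 4.7": for an
elliptic curve `E = W` over a number field `K`, ANY `ℤ_p`-extension `κ` with topological generator
`γ`, any Pontryagin-dual datum `D` of `Sel_{p^∞}(E/K_∞)` and any generator `f` of `char_Λ X(E/K_∞)`,
`f(0) · #(Sel_∞)_γ · #E[p^∞]^{Γ_K} = u · #Sel_{p^∞}(E/K) · #ker g_0`
(`WeierstrassCurve.SelmerDualData.constantCoeff_charGenerator_mul_natCard_of_finite_selmerGroup`,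
`IwasawaEulerCharRankZeroAssemblyProofs`; `…_of_no_pTorsion`, `IwasawaTowerTorsionProofs`), where
`ker g_0 = A_0 / Sel_0` (`WeierstrassCurve.KerG κ 0`, `A_0 = h_0⁻¹(Sel_∞)`). What is missing for
Theorem 4.1 itself is the passage `#ker g_0 = #ker r_0 · #(Sel_∞)_Γ / #E(F)_p` (Lemma 4.7,
Cassels–Poitou–Tate) and the local counts of Lemma 4.4 — neither is in the tree.

This file records the case in which NO duality is needed: if the `p`-power torsion `𝒦_{v,0}[p^∞]`
of every level-`0` local tower kernel vanishes (the socket family of rows T-T3CTL / T-T3B / T-GR34NA),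
every class of `A_0` already lies in `Sel_0` (Greenberg, Prop. 3.8, p. 96: "… hence that
`ker(g_0) = 0`"; tree mechanism `mem_selmerLayer_of_forall_localResOver_conjH1_eq_zero`, `S = ∅`), so
`#ker g_0 = 1` and the skeleton collapses to `f(0) · #(Sel_∞)_γ · #E[p^∞]^{Γ_K} = u · #Sel_{p^∞}(E/K)`.
Since the two cofactors on the left are positive natural numbers, `f(0) ∣ #Sel_{p^∞}(E/K)` in `ℤ_p`:
an INEQUALITY `ord_p f(0) ≤ ord_p #Sel_{p^∞}(E/K)` — the direction a LOWER half wants — with no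
Poitou–Tate, no Lemma 4.4 / 4.7, no Euler-characteristic theorem of Perrin-Riou–Schneider / Delbourgo.

* `localTowerKerPrimary_zero_eq_bot_of_finset` — the finite-set form of the socket hypothesis
  (`S ⊇ {v ∣ p} ∪ {bad v}`; good `v ∤ p` by the tree's Lemma 3.3, second part);
* `natCard_kerG_zero_eq_one_of_localTowerKerPrimary_eq_bot[_of_finset]` — **`#ker g_0 = 1`**;
* `constantCoeff_mul_natCard_eq_of_localTowerKerPrimary_eq_bot` / `…_of_finset` — the
  collapsed identity with the torsion term `#E[p^∞]^{Γ_K}` (hypothesis `[Finite E(K_∞)[p^∞]]`), and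
  `…_of_no_pTorsion[_of_finset]` — `E(K)[p] = 0` kills both the finiteness hypothesis and the torsion
  term: **`f(0) · #(Sel_∞)_γ = u · #Sel_{p^∞}(E/K)`**;
* `constantCoeff_dvd_natCard_selmer_of_no_pTorsion[_of_finset]` — **`f(0) ∣ #Sel`**
  in `ℤ_p`; `dvd_natCard_selmer_of_not_isUnit_of_no_pTorsion[_of_finset]` —
  **`f ∉ Λˣ ⟹ p ∣ #Sel_{p^∞}(E/K)`**, equivalently `char_Λ X ≠ Λ ⟹ p ∣ #Sel_{p^∞}(E/K)`
  (`…_of_charIdeal_ne_top…`) and **`μ(X) ≠ 0 ⟹ p ∣ #Sel_{p^∞}(E/K)`** (`…_of_mu_ne_zero…`);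
  bookkeeping `forall_smul_eq_zero_imp_of_not_dvd_torsionOrder` (`p ∤ #E(K)_tors ⟹ E(K)[p] = 0`).

All statements hold for any number field, any `ℤ_p`-extension, any reduction type; `Sel_{p^∞}(E/K)`
finite is a hypothesis (rank `0` use; in positive rank the identity is vacuous). The rank-`0`
reading over `ℚ` — the typed input `CycLowerBoundAt` ⟹ `Typed.MissingLowerBoundAt` without
Delbourgo 2002 (B) — is FILE 2 of the row (`Additive/GordCycLowerBoundOfControl`). Axioms standard.

References: [GreenbergLNM1716] R. Greenberg, *Iwasawa theory for elliptic curves*, LNM 1716 (1999),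
held copy `book:coatesnd-arithmetic-theory-elliptic-curves`: §3 Prop. 3.8 (pp. 95–96), §4 Thm. 4.1,
Lemmas 4.2–4.3 (pp. 102–103), p. 104, Lemmas 4.4, 4.7 (pp. 104, 107); cells/n1011/skel/T-CTL-EC.md.
-/

noncomputable section

open scoped Classical

universe u

namespace Summit.BirchSwinnertonDyer.Rank1Residual.Iwasawa

open Literature.NumberTheory.EllipticCurves Literature.NumberTheory.EllipticCurves.IwasawaDual
  NumberField IsDedekindDomain

/-! ## §1. Trivial local tower kernels ⟹ `ker g_0 = 0` -/

section KerG

variable {K : Type u} [Field K] [NumberField K] (W : WeierstrassCurve K) {p : ℕ} [Fact p.Prime]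
  (κ : ZpExtension K p)

/-- **The finite-set form of the socket hypothesis.** If `𝒦_{v,0}[p^∞] = ⊥` at every place of a
finite set `S` and every place outside `S` is prime to `p` and of good reduction, then
`𝒦_{v,0}[p^∞] = ⊥` at EVERY finite place `v` (at good `v ∤ p` the whole level-`0` local tower kernel
vanishes: Greenberg's Lemma 3.3, second part — tree theorem
`localTowerKer_zero_eq_bot_of_hasGoodReductionAt`). [cite: GreenbergLNM1716, §3 Lemma 3.3 (pp. 86–87)] -/
theorem localTowerKerPrimary_zero_eq_bot_of_finset [W.IsElliptic]
    (S : Finset (HeightOneSpectrum (𝓞 K)))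
    (hS : ∀ v ∈ S, W.localTowerKerPrimary κ (v.adicCompletion K) 0 = ⊥)
    (hgood : ∀ v ∉ S, (p : 𝓞 K) ∉ v.asIdeal ∧ W.HasGoodReductionAt v)
    (v : HeightOneSpectrum (𝓞 K)) :
    W.localTowerKerPrimary κ (v.adicCompletion K) 0 = ⊥ := by
  by_cases hv : v ∈ S
  · exact hS v hv
  · rw [eq_bot_iff]
    calc W.localTowerKerPrimary κ (v.adicCompletion K) 0
        ≤ W.localTowerKer κ (v.adicCompletion K) 0 :=
          W.localTowerKerPrimary_le_localTowerKer κ (v.adicCompletion K) 0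
      _ = ⊥ := W.localTowerKer_zero_eq_bot_of_hasGoodReductionAt κ v (hgood v hv).1 (hgood v hv).2
      _ ≤ ⊥ := le_rfl

/-- **`A_0 = Sel_0` under trivial local tower kernels**: every class of `A_0 = h_0⁻¹(Sel_∞)` lies in
`Sel_{p^∞}(E/K_0)` (the evaluation-map step of Greenberg's Lemma 3.5 with `S = ∅`,
`mem_selmerLayer_of_forall_localResOver_conjH1_eq_zero`). Greenberg, LNM 1716, Prop. 3.8, proof
(p. 96: "the map `𝒫_E(ℚ) → 𝒫_E(ℚ_∞)` is injective and hence … `ker(g_0) = 0`").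
[cite: GreenbergLNM1716, §3 Prop. 3.8 (proof, p. 96)] -/
theorem mem_selmerLayer_zero_of_mem_selmerInftyPreimage_of_localTowerKerPrimary_eq_bot
    (h0 : ∀ v : HeightOneSpectrum (𝓞 K), W.localTowerKerPrimary κ (v.adicCompletion K) 0 = ⊥)
    {y : W.subgroupH1 p (κ.layerSubgroup 0)} (hy : y ∈ W.selmerInftyPreimage κ 0) :
    y ∈ W.selmerLayer κ 0 :=
  W.mem_selmerLayer_of_forall_localResOver_conjH1_eq_zero κ ∅ (fun v _ ↦ h0 v) (fun _ ↦ ∅)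
    (fun v hv ↦ absurd hv (Finset.notMem_empty v)) hy
    (fun v hv ↦ absurd hv (Finset.notMem_empty v))

/-- **`ker g_0 = A_0 / Sel_0` is trivial under trivial local tower kernels** (any number field, any
`ℤ_p`-extension, any reduction type). [cite: GreenbergLNM1716, §3 Prop. 3.8 (proof, p. 96)] -/
theorem subsingleton_kerG_zero_of_localTowerKerPrimary_eq_bot
    (h0 : ∀ v : HeightOneSpectrum (𝓞 K), W.localTowerKerPrimary κ (v.adicCompletion K) 0 = ⊥) :
    Subsingleton (W.KerG κ 0) := by
  have htop : (W.selmerLayer κ 0).addSubgroupOf (W.selmerInftyPreimage κ 0) = ⊤ := by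
    rw [eq_top_iff]
    rintro ⟨y, hy⟩ -
    exact mem_selmerLayer_zero_of_mem_selmerInftyPreimage_of_localTowerKerPrimary_eq_bot W κ h0 hy
  change Subsingleton (↥(W.selmerInftyPreimage κ 0) ⧸
    (W.selmerLayer κ 0).addSubgroupOf (W.selmerInftyPreimage κ 0))
  rw [htop]
  exact QuotientAddGroup.subsingleton_quotient_top

/-- **`#ker g_0 = 1` under trivial local tower kernels.** [cite: GreenbergLNM1716, §3 Prop. 3.8 (proof, p. 96)] -/
theorem natCard_kerG_zero_eq_one_of_localTowerKerPrimary_eq_bot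
    (h0 : ∀ v : HeightOneSpectrum (𝓞 K), W.localTowerKerPrimary κ (v.adicCompletion K) 0 = ⊥) :
    Nat.card (W.KerG κ 0) = 1 := by
  haveI := subsingleton_kerG_zero_of_localTowerKerPrimary_eq_bot W κ h0
  exact Nat.card_unique

/-- **`#ker g_0 = 1`, finite-set form** (`S ⊇ {v ∣ p} ∪ {bad v}`).
[cite: GreenbergLNM1716, §3 Prop. 3.8 (proof, p. 96) and Lemma 3.3 (p. 87)] -/
theorem natCard_kerG_zero_eq_one_of_finset [W.IsElliptic]
    (S : Finset (HeightOneSpectrum (𝓞 K)))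
    (hS : ∀ v ∈ S, W.localTowerKerPrimary κ (v.adicCompletion K) 0 = ⊥)
    (hgood : ∀ v ∉ S, (p : 𝓞 K) ∉ v.asIdeal ∧ W.HasGoodReductionAt v) :
    Nat.card (W.KerG κ 0) = 1 :=
  natCard_kerG_zero_eq_one_of_localTowerKerPrimary_eq_bot W κ
    (localTowerKerPrimary_zero_eq_bot_of_finset W κ S hS hgood)

end KerG

/-! ## §2. The collapsed Euler-characteristic identity -/

section Identity

variable {K : Type u} [Field K] [NumberField K] (W : WeierstrassCurve K) [W.IsElliptic]
  {p : ℕ} [Fact p.Prime] {κ : ZpExtension K p} {γ : Field.absoluteGaloisGroup K}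

omit [W.IsElliptic] in
/-- **The Euler-characteristic identity with `ker g_0` killed by control.** For `E/K` elliptic over a
number field, ANY `ℤ_p`-extension `κ` with topological generator `γ`, any Pontryagin-dual datum `D`
and any generator `f` of `char_Λ X(E/K_∞)`: if `Sel_{p^∞}(E/K)` is finite, `E(K_∞)[p^∞]` is finite,
and every level-`0` local tower kernel has trivial `p`-power torsion, then `X` is finitely generated
`Λ`-torsion, `Sel_∞^γ` and `(Sel_∞)_γ` are finite, `f(0) ≠ 0`, and
**`f(0) · #(Sel_∞)_γ · #E[p^∞]^{Γ_K} = u · #Sel_{p^∞}(E/K)`** for some `u ∈ ℤ_pˣ` — Greenberg's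
Thm. 4.1 skeleton (Lemmas 4.2 × 4.3, `constantCoeff_charGenerator_mul_natCard_of_finite_selmerGroup`)
with `#ker g_0 = 1` (`natCard_kerG_zero_eq_one_of_localTowerKerPrimary_eq_bot`); no duality.
[cite: GreenbergLNM1716, §4 Thm. 4.1 (proof, pp. 102–103) and §3 Prop. 3.8 (p. 96)] -/
theorem constantCoeff_mul_natCard_eq_of_localTowerKerPrimary_eq_bot
    (D : W.SelmerDualData κ γ) (hγ : κ.IsTopGenerator γ) (hSel : Finite ↥(W.selmerGroupPInfty p))
    [Finite (FixedPoints.addSubgroup κ.kerSubgroup (WeierstrassCurve.geomPrimaryTorsion W p))]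
    (f : IwasawaAlgebra p) (hf : D.charIdeal = Ideal.span {f})
    (h0 : ∀ v : HeightOneSpectrum (𝓞 K), W.localTowerKerPrimary κ (v.adicCompletion K) 0 = ⊥) :
    Module.Finite (IwasawaAlgebra p) D.X ∧ Module.IsTorsion (IwasawaAlgebra p) D.X ∧
      Finite ↥(endInvariants (W.conjSelmerInfty κ γ - 1)) ∧
      Finite (EndCoinvariants (W.conjSelmerInfty κ γ - 1)) ∧ PowerSeries.constantCoeff f ≠ 0 ∧
      ∃ u : ℤ_[p]ˣ,
        PowerSeries.constantCoeff f *
            (Nat.card (EndCoinvariants (W.conjSelmerInfty κ γ - 1)) : ℤ_[p]) *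
            Nat.card (MulAction.fixedPoints (Field.absoluteGaloisGroup K)
              (WeierstrassCurve.geomPrimaryTorsion W p)) =
          u * Nat.card ↥(W.selmerGroupPInfty p) := by
  haveI := subsingleton_kerG_zero_of_localTowerKerPrimary_eq_bot W κ h0
  have hg : Finite (W.KerG κ 0) := Finite.of_subsingleton
  obtain ⟨hFG, hX, hfin, h1, h2, u, hu⟩ :=
    D.constantCoeff_charGenerator_mul_natCard_of_finite_selmerGroup W hγ hSel hg f hf
  refine ⟨hFG, hX, hfin, h1, h2, u, ?_⟩
  rwa [natCard_kerG_zero_eq_one_of_localTowerKerPrimary_eq_bot W κ h0, Nat.cast_one, mul_one] at hu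

/-- The same with the socket hypothesis on a finite `S ⊇ {v ∣ p} ∪ {bad v}`.
[cite: GreenbergLNM1716, §4 Thm. 4.1 (proof, pp. 102–103) and §3 Prop. 3.8 (p. 96)] -/
theorem constantCoeff_mul_natCard_eq_of_finset
    (D : W.SelmerDualData κ γ) (hγ : κ.IsTopGenerator γ) (hSel : Finite ↥(W.selmerGroupPInfty p))
    [Finite (FixedPoints.addSubgroup κ.kerSubgroup (WeierstrassCurve.geomPrimaryTorsion W p))]
    (f : IwasawaAlgebra p) (hf : D.charIdeal = Ideal.span {f})
    (S : Finset (HeightOneSpectrum (𝓞 K)))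
    (hS : ∀ v ∈ S, W.localTowerKerPrimary κ (v.adicCompletion K) 0 = ⊥)
    (hgood : ∀ v ∉ S, (p : 𝓞 K) ∉ v.asIdeal ∧ W.HasGoodReductionAt v) :
    Module.Finite (IwasawaAlgebra p) D.X ∧ Module.IsTorsion (IwasawaAlgebra p) D.X ∧
      Finite ↥(endInvariants (W.conjSelmerInfty κ γ - 1)) ∧
      Finite (EndCoinvariants (W.conjSelmerInfty κ γ - 1)) ∧ PowerSeries.constantCoeff f ≠ 0 ∧
      ∃ u : ℤ_[p]ˣ,
        PowerSeries.constantCoeff f *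
            (Nat.card (EndCoinvariants (W.conjSelmerInfty κ γ - 1)) : ℤ_[p]) *
            Nat.card (MulAction.fixedPoints (Field.absoluteGaloisGroup K)
              (WeierstrassCurve.geomPrimaryTorsion W p)) =
          u * Nat.card ↥(W.selmerGroupPInfty p) :=
  constantCoeff_mul_natCard_eq_of_localTowerKerPrimary_eq_bot W D hγ hSel f hf
    (localTowerKerPrimary_zero_eq_bot_of_finset W κ S hS hgood)

/-- **`E(K)[p] = 0` form: `f(0) · #(Sel_∞)_γ = u · #Sel_{p^∞}(E/K)`.** With no `K`-rational point of
order `p`, `E(K_∞)[p^∞] = 0` for every `ℤ_p`-extension (`IwasawaTowerTorsionProofs`), so both the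
finiteness hypothesis and the torsion term disappear (Greenberg, p. 104: "consider theorem 4.1 in the
case where `E(F)_p = 0`"). [cite: GreenbergLNM1716, §4 Thm. 4.1 (proof, pp. 102–104) and §3 Prop. 3.8 (p. 96)] -/
theorem constantCoeff_mul_natCard_eq_of_no_pTorsion
    (D : W.SelmerDualData κ γ) (hγ : κ.IsTopGenerator γ) (hSel : Finite ↥(W.selmerGroupPInfty p))
    (hK : ∀ P : W.toAffine.Point, p • P = 0 → P = 0)
    (f : IwasawaAlgebra p) (hf : D.charIdeal = Ideal.span {f})
    (h0 : ∀ v : HeightOneSpectrum (𝓞 K), W.localTowerKerPrimary κ (v.adicCompletion K) 0 = ⊥) :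
    Module.Finite (IwasawaAlgebra p) D.X ∧ Module.IsTorsion (IwasawaAlgebra p) D.X ∧
      Finite ↥(endInvariants (W.conjSelmerInfty κ γ - 1)) ∧
      Finite (EndCoinvariants (W.conjSelmerInfty κ γ - 1)) ∧ PowerSeries.constantCoeff f ≠ 0 ∧
      ∃ u : ℤ_[p]ˣ,
        PowerSeries.constantCoeff f *
            (Nat.card (EndCoinvariants (W.conjSelmerInfty κ γ - 1)) : ℤ_[p]) =
          u * Nat.card ↥(W.selmerGroupPInfty p) := by
  haveI := subsingleton_kerG_zero_of_localTowerKerPrimary_eq_bot W κ h0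
  have hg : Finite (W.KerG κ 0) := Finite.of_subsingleton
  obtain ⟨hFG, hX, hfin, h1, h2, u, hu⟩ :=
    D.constantCoeff_charGenerator_mul_natCard_of_finite_selmerGroup_of_no_pTorsion W hγ hSel hg hK f hf
  refine ⟨hFG, hX, hfin, h1, h2, u, ?_⟩
  rwa [natCard_kerG_zero_eq_one_of_localTowerKerPrimary_eq_bot W κ h0, Nat.cast_one, mul_one] at hu

/-- `E(K)[p] = 0` form, socket hypothesis on a finite `S ⊇ {v ∣ p} ∪ {bad v}`:
**`f(0) · #(Sel_∞)_γ = u · #Sel_{p^∞}(E/K)`**. [cite: GreenbergLNM1716, §4 Thm. 4.1 (proof, pp. 102–104) and §3 Prop. 3.8 (p. 96)] -/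
theorem constantCoeff_mul_natCard_eq_of_no_pTorsion_of_finset
    (D : W.SelmerDualData κ γ) (hγ : κ.IsTopGenerator γ) (hSel : Finite ↥(W.selmerGroupPInfty p))
    (hK : ∀ P : W.toAffine.Point, p • P = 0 → P = 0)
    (f : IwasawaAlgebra p) (hf : D.charIdeal = Ideal.span {f})
    (S : Finset (HeightOneSpectrum (𝓞 K)))
    (hS : ∀ v ∈ S, W.localTowerKerPrimary κ (v.adicCompletion K) 0 = ⊥)
    (hgood : ∀ v ∉ S, (p : 𝓞 K) ∉ v.asIdeal ∧ W.HasGoodReductionAt v) :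
    Module.Finite (IwasawaAlgebra p) D.X ∧ Module.IsTorsion (IwasawaAlgebra p) D.X ∧
      Finite ↥(endInvariants (W.conjSelmerInfty κ γ - 1)) ∧
      Finite (EndCoinvariants (W.conjSelmerInfty κ γ - 1)) ∧ PowerSeries.constantCoeff f ≠ 0 ∧
      ∃ u : ℤ_[p]ˣ,
        PowerSeries.constantCoeff f *
            (Nat.card (EndCoinvariants (W.conjSelmerInfty κ γ - 1)) : ℤ_[p]) =
          u * Nat.card ↥(W.selmerGroupPInfty p) :=
  constantCoeff_mul_natCard_eq_of_no_pTorsion W D hγ hSel hK f hf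
    (localTowerKerPrimary_zero_eq_bot_of_finset W κ S hS hgood)

end Identity

/-! ## §3. Corollaries: `f(0) ∣ #Sel_{p^∞}(E/K)`; `f ∉ Λˣ ⟹ p ∣ #Sel_{p^∞}(E/K)` -/

section Corollaries

variable {K : Type u} [Field K] [NumberField K] (W : WeierstrassCurve K) [W.IsElliptic]
  {p : ℕ} [hp : Fact p.Prime] {κ : ZpExtension K p} {γ : Field.absoluteGaloisGroup K}

omit [NumberField K] [W.IsElliptic] in
/-- `p ∤ #E(K)_tors ⇒ E(K)[p] = 0`: a non-zero point killed by `p` has order `p`, a divisor of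
`#E(K)_tors` (the binder `hK` of the `…_of_no_pTorsion` theorems from the census column
`#E(K)_tors`). [cite: SilvermanAEC2009, Thm. VIII.6.7] -/
theorem forall_smul_eq_zero_imp_of_not_dvd_torsionOrder (htors : ¬ p ∣ W.torsionOrder) :
    ∀ P : W.toAffine.Point, p • P = 0 → P = 0 := by
  intro P hP
  by_contra hP0
  have hord : addOrderOf P ∣ p := addOrderOf_dvd_of_nsmul_eq_zero hP
  rcases (Nat.dvd_prime hp.out).mp hord with h1 | hpe
  · exact hP0 (AddMonoid.addOrderOf_eq_one_iff.mp h1)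
  · have hfin : IsOfFinAddOrder P := by
      rw [← addOrderOf_pos_iff, hpe]; exact hp.out.pos
    have hmemT : P ∈ AddCommGroup.torsion W.toAffine.Point := by
      rw [AddCommGroup.mem_torsion]; exact hfin
    have hordT : addOrderOf (⟨P, hmemT⟩ : AddCommGroup.torsion W.toAffine.Point) = addOrderOf P :=
      AddSubgroup.addOrderOf_mk P hmemT
    apply htors
    have h := addOrderOf_dvd_natCard (⟨P, hmemT⟩ : AddCommGroup.torsion W.toAffine.Point)
    rw [hordT, hpe] at h
    exact h

/-- `p ∣ n` in `ℕ` from `(p : ℤ_p) ∣ (n : ℤ_p)`. [folklore] -/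
private theorem natCast_dvd_of_padicInt_dvd {n : ℕ} (h : (p : ℤ_[p]) ∣ (n : ℤ_[p])) : p ∣ n := by
  have h1 : ‖((n : ℤ) : ℤ_[p])‖ < 1 := by
    rw [Int.cast_natCast]
    exact PadicInt.norm_lt_one_iff_dvd _ |>.mpr h
  have h2 : (p : ℤ) ∣ (n : ℤ) := (PadicInt.norm_int_lt_one_iff_dvd (n : ℤ)).mp h1
  exact_mod_cast h2

/-- A non-unit of `Λ = ℤ_p⟦T⟧` has constant term divisible by `p` (`Λ` is local with maximal ideal
`(p, T)`; Mathlib `PowerSeries.isUnit_iff_constantCoeff`, `PadicInt.norm_lt_one_iff_dvd`). [folklore] -/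
private theorem p_dvd_constantCoeff_of_not_isUnit {f : IwasawaAlgebra p} (hf : ¬ IsUnit f) :
    (p : ℤ_[p]) ∣ PowerSeries.constantCoeff f := by
  have h1 : ¬ IsUnit (PowerSeries.constantCoeff f) := fun h ↦
    hf (PowerSeries.isUnit_iff_constantCoeff.mpr h)
  rw [← PadicInt.norm_lt_one_iff_dvd]
  exact lt_of_le_of_ne (PadicInt.norm_le_one _) fun h ↦ h1 (PadicInt.isUnit_iff.mpr h)

/-- **`f(0) ∣ #Sel_{p^∞}(E/K)` in `ℤ_p`** (`E(K)[p] = 0`, `Sel_{p^∞}(E/K)` finite, trivial level-`0`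
local tower kernels): from `f(0) · #(Sel_∞)_γ = u · #Sel_{p^∞}(E/K)`. In valuations:
`ord_p f(0) ≤ ord_p #Sel_{p^∞}(E/K)` — the duality-free Euler-characteristic INEQUALITY.
[cite: GreenbergLNM1716, §4 Thm. 4.1 (proof, pp. 102–104) and §3 Prop. 3.8 (p. 96)] -/
theorem constantCoeff_dvd_natCard_selmer_of_no_pTorsion
    (D : W.SelmerDualData κ γ) (hγ : κ.IsTopGenerator γ) (hSel : Finite ↥(W.selmerGroupPInfty p))
    (hK : ∀ P : W.toAffine.Point, p • P = 0 → P = 0)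
    (f : IwasawaAlgebra p) (hf : D.charIdeal = Ideal.span {f})
    (h0 : ∀ v : HeightOneSpectrum (𝓞 K), W.localTowerKerPrimary κ (v.adicCompletion K) 0 = ⊥) :
    PowerSeries.constantCoeff f ∣ (Nat.card ↥(W.selmerGroupPInfty p) : ℤ_[p]) := by
  obtain ⟨-, -, -, -, -, u, hu⟩ := constantCoeff_mul_natCard_eq_of_no_pTorsion W D hγ hSel hK f hf h0
  refine ⟨↑u⁻¹ * (Nat.card (EndCoinvariants (W.conjSelmerInfty κ γ - 1)) : ℤ_[p]), ?_⟩
  calc (Nat.card ↥(W.selmerGroupPInfty p) : ℤ_[p])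
      = ↑u⁻¹ * (↑u * Nat.card ↥(W.selmerGroupPInfty p)) := by
        rw [← mul_assoc, Units.inv_mul, one_mul]
    _ = ↑u⁻¹ * (PowerSeries.constantCoeff f *
          (Nat.card (EndCoinvariants (W.conjSelmerInfty κ γ - 1)) : ℤ_[p])) := by rw [hu]
    _ = PowerSeries.constantCoeff f *
          (↑u⁻¹ * (Nat.card (EndCoinvariants (W.conjSelmerInfty κ γ - 1)) : ℤ_[p])) := by ring

/-- `f(0) ∣ #Sel_{p^∞}(E/K)` in `ℤ_p`, socket hypothesis on a finite `S ⊇ {v ∣ p} ∪ {bad v}`.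
[cite: GreenbergLNM1716, §4 Thm. 4.1 (proof, pp. 102–104) and §3 Prop. 3.8 (p. 96)] -/
theorem constantCoeff_dvd_natCard_selmer_of_no_pTorsion_of_finset
    (D : W.SelmerDualData κ γ) (hγ : κ.IsTopGenerator γ) (hSel : Finite ↥(W.selmerGroupPInfty p))
    (hK : ∀ P : W.toAffine.Point, p • P = 0 → P = 0)
    (f : IwasawaAlgebra p) (hf : D.charIdeal = Ideal.span {f})
    (S : Finset (HeightOneSpectrum (𝓞 K)))
    (hS : ∀ v ∈ S, W.localTowerKerPrimary κ (v.adicCompletion K) 0 = ⊥)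
    (hgood : ∀ v ∉ S, (p : 𝓞 K) ∉ v.asIdeal ∧ W.HasGoodReductionAt v) :
    PowerSeries.constantCoeff f ∣ (Nat.card ↥(W.selmerGroupPInfty p) : ℤ_[p]) :=
  constantCoeff_dvd_natCard_selmer_of_no_pTorsion W D hγ hSel hK f hf
    (localTowerKerPrimary_zero_eq_bot_of_finset W κ S hS hgood)

/-- **`f ∉ Λˣ ⟹ p ∣ #Sel_{p^∞}(E/K)`** (`E(K)[p] = 0`, `Sel_{p^∞}(E/K)` finite, trivial level-`0`
local tower kernels): a non-trivial characteristic power series forces a class of order `p` in the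
Selmer group over the BASE field — the converse companion of T-T3CTL F1 (`#Sel = 1 ⟹ X = 0`), now
quantitative. [cite: GreenbergLNM1716, §4 Thm. 4.1 (proof, pp. 102–104) and §3 Prop. 3.8 (p. 96)] -/
theorem dvd_natCard_selmer_of_not_isUnit_of_no_pTorsion
    (D : W.SelmerDualData κ γ) (hγ : κ.IsTopGenerator γ) (hSel : Finite ↥(W.selmerGroupPInfty p))
    (hK : ∀ P : W.toAffine.Point, p • P = 0 → P = 0)
    (f : IwasawaAlgebra p) (hf : D.charIdeal = Ideal.span {f}) (hunit : ¬ IsUnit f)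
    (h0 : ∀ v : HeightOneSpectrum (𝓞 K), W.localTowerKerPrimary κ (v.adicCompletion K) 0 = ⊥) :
    p ∣ Nat.card ↥(W.selmerGroupPInfty p) :=
  natCast_dvd_of_padicInt_dvd ((p_dvd_constantCoeff_of_not_isUnit hunit).trans
    (constantCoeff_dvd_natCard_selmer_of_no_pTorsion W D hγ hSel hK f hf h0))

/-- `f ∉ Λˣ ⟹ p ∣ #Sel_{p^∞}(E/K)`, socket hypothesis on a finite `S ⊇ {v ∣ p} ∪ {bad v}`.
[cite: GreenbergLNM1716, §4 Thm. 4.1 (proof, pp. 102–104) and §3 Prop. 3.8 (p. 96)] -/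
theorem dvd_natCard_selmer_of_not_isUnit_of_no_pTorsion_of_finset
    (D : W.SelmerDualData κ γ) (hγ : κ.IsTopGenerator γ) (hSel : Finite ↥(W.selmerGroupPInfty p))
    (hK : ∀ P : W.toAffine.Point, p • P = 0 → P = 0)
    (f : IwasawaAlgebra p) (hf : D.charIdeal = Ideal.span {f}) (hunit : ¬ IsUnit f)
    (S : Finset (HeightOneSpectrum (𝓞 K)))
    (hS : ∀ v ∈ S, W.localTowerKerPrimary κ (v.adicCompletion K) 0 = ⊥)
    (hgood : ∀ v ∉ S, (p : 𝓞 K) ∉ v.asIdeal ∧ W.HasGoodReductionAt v) :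
    p ∣ Nat.card ↥(W.selmerGroupPInfty p) :=
  dvd_natCard_selmer_of_not_isUnit_of_no_pTorsion W D hγ hSel hK f hf hunit
    (localTowerKerPrimary_zero_eq_bot_of_finset W κ S hS hgood)

/-- **`char_Λ X(E/K_∞) ≠ Λ ⟹ p ∣ #Sel_{p^∞}(E/K)`** (`E(K)[p] = 0`, `Sel_{p^∞}(E/K)` finite, trivial
level-`0` local tower kernels; the characteristic ideal is principal, `charIdeal_isPrincipal_holds`).
[cite: GreenbergLNM1716, §4 Thm. 4.1 (proof, pp. 102–104) and §3 Prop. 3.8 (p. 96)] -/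
theorem dvd_natCard_selmer_of_charIdeal_ne_top_of_no_pTorsion
    (D : W.SelmerDualData κ γ) (hγ : κ.IsTopGenerator γ) (hSel : Finite ↥(W.selmerGroupPInfty p))
    (hK : ∀ P : W.toAffine.Point, p • P = 0 → P = 0) (hchar : D.charIdeal ≠ ⊤)
    (h0 : ∀ v : HeightOneSpectrum (𝓞 K), W.localTowerKerPrimary κ (v.adicCompletion K) 0 = ⊥) :
    p ∣ Nat.card ↥(W.selmerGroupPInfty p) := by
  haveI : (Module.charIdeal (IwasawaAlgebra p) D.X).IsPrincipal := charIdeal_isPrincipal_holds p D.X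
  obtain ⟨f, hf⟩ := Submodule.IsPrincipal.principal (Module.charIdeal (IwasawaAlgebra p) D.X)
  have hf' : D.charIdeal = Ideal.span {f} := hf
  refine dvd_natCard_selmer_of_not_isUnit_of_no_pTorsion W D hγ hSel hK f hf' (fun hu ↦ hchar ?_) h0
  rw [hf', Ideal.span_singleton_eq_top]
  exact hu

/-- **`μ(X) ≠ 0 ⟹ p ∣ #Sel_{p^∞}(E/K)`** (`E(K)[p] = 0`, `Sel_{p^∞}(E/K)` finite, trivial level-`0` local
tower kernels): a positive `μ`-invariant means `p ∣ f` in `Λ` for every generator `f` of the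
characteristic ideal (`muInvariant_eq_zero_iff_not_C_dvd_of_charIdeal_eq_span`, Greenberg–Vatsal 2000
p. 2), so `f ∉ Λˣ`. [cite: GreenbergLNM1716, §4 Thm. 4.1 (proof, pp. 102–104) and §3 Prop. 3.8 (p. 96)]
[cite: GreenbergVatsal2000, p. 2, (1)–(2)] -/
theorem dvd_natCard_selmer_of_mu_ne_zero_of_no_pTorsion
    (D : W.SelmerDualData κ γ) (hγ : κ.IsTopGenerator γ) (hSel : Finite ↥(W.selmerGroupPInfty p))
    (hK : ∀ P : W.toAffine.Point, p • P = 0 → P = 0) (hμ : D.mu ≠ 0)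
    (h0 : ∀ v : HeightOneSpectrum (𝓞 K), W.localTowerKerPrimary κ (v.adicCompletion K) 0 = ⊥) :
    p ∣ Nat.card ↥(W.selmerGroupPInfty p) := by
  haveI : (Module.charIdeal (IwasawaAlgebra p) D.X).IsPrincipal := charIdeal_isPrincipal_holds p D.X
  obtain ⟨f, hf⟩ := Submodule.IsPrincipal.principal (Module.charIdeal (IwasawaAlgebra p) D.X)
  have hf' : D.charIdeal = Ideal.span {f} := hf
  obtain ⟨hFG, hX, -, -, -, -⟩ := constantCoeff_mul_natCard_eq_of_no_pTorsion W D hγ hSel hK f hf' h0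
  haveI := hFG
  refine dvd_natCard_selmer_of_not_isUnit_of_no_pTorsion W D hγ hSel hK f hf' (fun hunit ↦ hμ ?_) h0
  change muInvariant p D.X = 0
  rw [muInvariant_eq_zero_iff_not_C_dvd_of_charIdeal_eq_span D.X hX hf]
  intro hC
  have hCu : IsUnit (PowerSeries.C (p : ℤ_[p])) := isUnit_of_dvd_unit hC hunit
  have hpu : IsUnit ((p : ℕ) : ℤ_[p]) := by
    have h := hCu.map (PowerSeries.constantCoeff (R := ℤ_[p]))
    rwa [PowerSeries.constantCoeff_C] at h
  have hnorm : ‖((p : ℕ) : ℤ_[p])‖ = 1 := PadicInt.isUnit_iff.mp hpu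
  rw [PadicInt.norm_p] at hnorm
  have hp1 : (1 : ℝ) < p := by exact_mod_cast hp.out.one_lt
  have : (p : ℝ)⁻¹ < 1 := inv_lt_one_of_one_lt₀ hp1
  exact absurd hnorm this.ne

end Corollaries

end Summit.BirchSwinnertonDyer.Rank1Residual.Iwasawa

end
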